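import Summits.HodgeConjecture.HodgeConjecture.Theorems.EquidimHeckeQuotientTriplesOfPiece
import Literature.AlgebraicGeometry.ModuliOfAbelianVarieties.SiegelUniversalFamilyPieceDualStableCover
import Literature.AlgebraicGeometry.AbelianSchemes.AbelianSchemeConstSubgroupQuotientGroupLaw
import Literature.AlgebraicGeometry.AbelianSchemes.AbelianSchemeConstSubgroupQuotientSmooth
import Literature.AlgebraicGeometry.AbelianSchemes.AbelianSchemeOverHomOfReduced
import Literature.AlgebraicGeometry.AbelianSchemes.PolarizationLamTranslationInvariance
import Literature.AlgebraicGeometry.AbelianSchemes.PolarizationLamImageFree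
import Literature.AlgebraicGeometry.AbelianSchemes.AbelianSchemeQuotientPolarizationExistsAmple
import Literature.AlgebraicGeometry.AbelianSchemes.AbelianSchemeQuotientHatCompDual
import Literature.AlgebraicGeometry.AbelianSchemes.HeckeQuotientTripleHasTypeOfCards
import Literature.AlgebraicGeometry.AbelianSchemes.AbelianSchemeQuotientPoincareStabilizerOfMap
import Literature.AlgebraicGeometry.AbelianSchemes.AbelianSchemeQuotientPoincareEquivariant
import Literature.AlgebraicGeometry.AbelianSchemes.AbelianSchemeQuotientPoincareIsotropyOfFibre
import Literature.AlgebraicGeometry.ModuliOfAbelianVarieties.SiegelHeckeKernelIsotropic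
import Literature.AlgebraicGeometry.ModuliOfAbelianVarieties.SiegelHeckeDatumIntegral
import Literature.AlgebraicGeometry.ModuliOfAbelianVarieties.SiegelTripleDualLevelStructure
import Literature.AlgebraicGeometry.AbelianSchemes.AbelianSchemeQuotientDualPairUniversalOfLevel
import Literature.AlgebraicGeometry.AbelianSchemes.PoincarePullbackStabilizerOfLevel
import Literature.AlgebraicGeometry.AbelianSchemes.RigidifiedTrivialFpqcDescent
import Literature.AlgebraicGeometry.AbelianSchemes.LevelSectionsMapSubsetHatRange
import Literature.AlgebraicGeometry.AbelianSchemes.LevelSectionsSubgroupCard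
import HarnessLib

/-!
# The (ii)-chain package `hExt` over the thick open piece — the COMPOSER of socket (QT)

Sub-problem `HodgeConjecture`, E-road v1.4a → v1.5 (`Cruxes/HDel/Lines/EquidimOfF.lean`): the one remaining sorry
`stub_quotientTriples₈ : SocketQuotientTriples₈` is ★ `EquidimHeckeQuotientTriplesOfPiece.socketQuotientTriples_of_ext … γm hγ hExt`
modulo its LAST hypothesis `hExt` — the (ii)-chain package for the universal family pulled back to the piece
(`P′ := 𝓜′.univ|S″`, `u := S″.hom`).  This file proves `hExt` (same outer binders as the assembler, conclusion = its `hExt`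
binder VERBATIM), conjunct by conjunct from the hands' ★ files:

* `hcov` ★ `hcov_univ_piece′` (quasi-projectivity of the universal total space, (W1) ★ `W1.smooth_qproj_of_F`);
* `hG`/`hsm`/`hgc` ★ `exists_grpObj_isMonHom_quotientMk` / `smooth_quotientOver_hom_of_hom_spec` / `geometricallyConnected_quotientOver_hom`;
* `K′ := λ′_* K = K.map (IsMonHom.monoidHom λ′ 𝟙)`, `Finite K′` ★ `finite_map_isMonHom_monoidHom`, `hlam` ★ `hlam_map`,
  `hfree′` ★ `translation_ne_of_mem_map_lam`;
* `hcov′` ★ `hcov'_univ_piece` ((B5): the dual total space is covered by `K′`-stable affine opens over `Spec ℂ`, via the affine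
  quasi-inverse of `λ′`);
* `hG′`/`hsm′`/`hgc′` — the same three ★ quotient lemmas on the dual side;
* `Φ`, `h4` — the D6 package (equivariant structure on `𝒩₁` and the universal property of the descended rigidified
  Poincaré sheaf);
* `polB`, `hpolB` ★ `exists_polarization_lam_eq_polarizationDesc_of_charZero_of_odd` (odd `d`, char. 0, `λ′` onto on
  geometric points ★ `exists_comp_lam_eq_of_classify`);
* `htype` ★ `Polarization.hasType_polarizationDesc_of_count` (coprimality from the socket, `λ_B` onto ★
  `surjective_map_fibreHom_of_lam_eq_polarizationDesc`, and the kernel count).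

References: [MumfordAV1970, §7 Thm. 4 p. 72, §23 Thm. 2 p. 231, §15 Thm. 1 p. 143]; [MumfordFogartyKirwan1994, Ch. 7 §3
Thm. 7.9 p. 139]; [Milne2005ShimuraVarieties, §6 Thm. 6.11 pp. 74–75].
-/

open CategoryTheory CategoryTheory.Limits AlgebraicGeometry Matrix MonoidalCategory
open scoped MonObj
open Literature.AlgebraicGeometry.Motives (SchemeOver ComplexPoints AlgPoints specOver baseChangeHomFst)
open Literature.AlgebraicGeometry.AbelianSchemes (PolarizedAbelianSchemeWithLevel AbelianSchemeOver)
open Literature.NumberTheory.Automorphic (siegelUpperHalfSpace)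
open Literature.NumberTheory.Adeles
open Literature.AlgebraicGeometry.ModuliOfAbelianVarieties
open Literature.AlgebraicGeometry.HodgeTheory (IsQuasiProjectiveOver)
open Literature.AlgebraicGeometry (Motives.CartierDivisor Motives.AbelianVariety.Hom.toSchemeHom
  AbelianSchemes.AbelianSchemeOver.isDominant_toSchemeHom_fibreHom AbelianSchemes.AbelianSchemeOver.fibreHom)

set_option linter.dupNamespace false  -- `Summit.HodgeConjecture.HodgeConjecture.…` is the cell's layout (D-0017)

namespace Summit.HodgeConjecture.HodgeConjecture.Theorems.EquidimHExtOfPiece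

open SiegelModuli

/-- `(m : Ω) ≠ 0` for `m ≠ 0` at a field-valued point of a scheme over a field of characteristic zero.
[cite: MumfordFogartyKirwan1994, Ch. 7 §3 (p. 139)] -/
theorem natCast_ne_zero_of_over_charZero {S : Scheme} {F : Type} [Field F] [CharZero F] (f : S ⟶ Spec (.of F))
    {Ω : Type} [Field Ω] (s : Spec (.of Ω) ⟶ S) {m : ℕ} (hm : m ≠ 0) : (m : Ω) ≠ 0 := by
  let φ : F →+* Ω := (Spec.preimage (s ≫ f)).hom
  rw [← map_natCast φ m]
  exact (map_ne_zero φ).mpr (Nat.cast_ne_zero.mpr hm)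

set_option maxHeartbeats 400000 in
/-- **THE (ii)-CHAIN PACKAGE `hExt` OVER THE THICK OPEN PIECE** — the last hypothesis of ★
`EquidimHeckeQuotientTriplesOfPiece.socketQuotientTriples_of_ext`, with the same outer binders (so that
`socketQuotientTriples_of_ext … γm hγ (hExt_of_piece … γm hγ)` closes `stub_quotientTriples₈`).  See the module docstring for
the conjunct-by-conjunct sources.
[cite: MumfordAV1970, §7 Thm. 4 (p. 72), §23 Thm. 2 (p. 231) and §15 Thm. 1 (p. 143)]
[cite: MumfordFogartyKirwan1994, Ch. 7 §3 Theorem 7.9 (p. 139)] [cite: Milne2005ShimuraVarieties, §6 Thm. 6.11 pp. 74–75] -/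
theorem hExt_of_piece (hF : lan2013_siegelFineModuliScheme) (g N N' : ℕ) (δ δ' : Fin g → ℕ) (hg : 0 < g)
    (hδ : IsPolarizationType δ) (hN : 3 ≤ N) (hδ' : IsPolarizationType δ') (𝓜 : SiegelFineModuliScheme g N δ)
    (𝓜' : SiegelFineModuliScheme g N' δ') (S'' : SchemeOver ℂ)
    (ι' : S'' ⟶ (Literature.AlgebraicGeometry.Motives.baseChange ℚ ℂ).obj 𝓜'.M) [IsOpenImmersion ι'.left]
    (d'' : ℕ) [SmoothOfRelativeDimension d'' S''.hom] (r' : gspFinAdelic δ') (hr' : r' ∈ principalLevelSubgroup δ' 1)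
    (s' : ComplexPoints S'') (_hth : EquidimOfF.IsThickAtWith hδ' 𝓜' ι' d'' s' r')
    (x : ComplexPoints ((Literature.AlgebraicGeometry.Motives.baseChange ℚ ℂ).obj 𝓜.M))
    (hlink : HeckeLinkedDeg 𝓜 𝓜' r' (AlgPoints.map (L := ℂ) ι' s') x (N' / N)) (hodd : Odd (N' / N))
    (hcop : Nat.Coprime (N' / N) (∏ i, δ i)) [NeZero N'] (ι'ℚ : S''.restrictScalars ℚ ⟶ 𝓜'.M)
    (hι : ι'.left ≫ baseChangeHomFst (algebraMap ℚ ℂ) 𝓜'.M = ι'ℚ.left)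
    (γq : GL (Fin g ⊕ Fin g) ℚ) (r : gspFinAdelic δ) (hr : r ∈ principalLevelSubgroup δ 1)
    (hQA : QuotientAdapted δ δ' N N' r r' γq)
    (hsim : (γq : Matrix (Fin g ⊕ Fin g) (Fin g ⊕ Fin g) ℚ)ᵀ * typeFormOver δ ℚ *
      (γq : Matrix (Fin g ⊕ Fin g) (Fin g ⊕ Fin g) ℚ) = (((N' / N : ℕ) : ℚ)) • typeFormOver δ' ℚ)
    (γm : Matrix (Fin g ⊕ Fin g) (Fin g ⊕ Fin g) ℤ)
    (hγ : ((γq : GL (Fin g ⊕ Fin g) ℚ) : Matrix (Fin g ⊕ Fin g) (Fin g ⊕ Fin g) ℚ) = γm.map (Int.cast : ℤ → ℚ)) :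
    ∀ (d : ℕ), N' = N * d →
      ∀ [IsReduced S''.left] [IsLocallyNoetherian S''.left] [S''.left.IsSeparated]
        [IsSeparated ((PolarizedAbelianSchemeWithLevel.baseChange (S' := S''.left) 𝓜'.univ ι'ℚ.left).A.X.hom ≫ S''.hom)] [LocallyOfFiniteType ((PolarizedAbelianSchemeWithLevel.baseChange (S' := S''.left) 𝓜'.univ ι'ℚ.left).A.X.hom ≫ S''.hom)]
        [IsSeparated ((PolarizedAbelianSchemeWithLevel.baseChange (S' := S''.left) 𝓜'.univ ι'ℚ.left).D.hat.X.hom ≫ S''.hom)] [LocallyOfFiniteType ((PolarizedAbelianSchemeWithLevel.baseChange (S' := S''.left) 𝓜'.univ ι'ℚ.left).D.hat.X.hom ≫ S''.hom)]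
        [IsCommMonObj (PolarizedAbelianSchemeWithLevel.baseChange (S' := S''.left) 𝓜'.univ ι'ℚ.left).A.X]
        (K : Subgroup (PolarizedAbelianSchemeWithLevel.baseChange (S' := S''.left) 𝓜'.univ ι'ℚ.left).A.Sections) [Finite K]
        (hK : ∀ σ : K, (σ : (PolarizedAbelianSchemeWithLevel.baseChange (S' := S''.left) 𝓜'.univ ι'ℚ.left).A.Sections) ^ d = 1)
        (hfree : ∀ (Ω : Type) [Field Ω] [IsAlgClosed Ω] (x : Spec (.of Ω) ⟶ (PolarizedAbelianSchemeWithLevel.baseChange (S' := S''.left) 𝓜'.univ ι'ℚ.left).A.left) (σ : K), σ ≠ 1 →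
          x ≫ ((PolarizedAbelianSchemeWithLevel.baseChange (S' := S''.left) 𝓜'.univ ι'ℚ.left).A.translation (σ : (PolarizedAbelianSchemeWithLevel.baseChange (S' := S''.left) 𝓜'.univ ι'ℚ.left).A.Sections)).left ≠ x)
        (_ : ∀ σ : (PolarizedAbelianSchemeWithLevel.baseChange (S' := S''.left) 𝓜'.univ ι'ℚ.left).A.Sections, σ ∈ K ↔ ∃ c ∈ {c : Fin g ⊕ Fin g → ZMod N' |
            (γm.map (Int.castRingHom (ZMod N')) *
              Matrix.of (fun i j => integralAdeleResidue N'
                ⟨((r' : GL (Fin g ⊕ Fin g) finAdeleQ) : Matrix (Fin g ⊕ Fin g) (Fin g ⊕ Fin g) finAdeleQ) i j,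
                  entries_mem_integralAdeles_of_mem_principalLevelSubgroup_one hr' i j⟩)) *ᵥ c = 0},
            (PolarizedAbelianSchemeWithLevel.baseChange (S' := S''.left) 𝓜'.univ ι'ℚ.left).level.section_ c = σ),
        ∃ (hcov : ∀ x : (PolarizedAbelianSchemeWithLevel.baseChange (S' := S''.left) 𝓜'.univ ι'ℚ.left).A.left, ∃ O : ((PolarizedAbelianSchemeWithLevel.baseChange (S' := S''.left) 𝓜'.univ ι'ℚ.left).A.translationActionOver S''.hom K).StableAffineOpens, x ∈ O.1)
          (hG : ∃ _ : GrpObj ((PolarizedAbelianSchemeWithLevel.baseChange (S' := S''.left) 𝓜'.univ ι'ℚ.left).A.quotientOver S''.hom K), IsMonHom ((PolarizedAbelianSchemeWithLevel.baseChange (S' := S''.left) 𝓜'.univ ι'ℚ.left).A.quotientMk S''.hom K hcov))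
          (hsm : Smooth ((PolarizedAbelianSchemeWithLevel.baseChange (S' := S''.left) 𝓜'.univ ι'ℚ.left).A.quotientOver S''.hom K).hom)
          (hgc : GeometricallyConnected ((PolarizedAbelianSchemeWithLevel.baseChange (S' := S''.left) 𝓜'.univ ι'ℚ.left).A.quotientOver S''.hom K).hom)
          (K' : Subgroup (PolarizedAbelianSchemeWithLevel.baseChange (S' := S''.left) 𝓜'.univ ι'ℚ.left).D.hat.Sections) (_ : Finite K')
          (hcov' : ∀ x : (PolarizedAbelianSchemeWithLevel.baseChange (S' := S''.left) 𝓜'.univ ι'ℚ.left).D.hat.left, ∃ O : ((PolarizedAbelianSchemeWithLevel.baseChange (S' := S''.left) 𝓜'.univ ι'ℚ.left).D.hat.translationActionOver S''.hom K').StableAffineOpens, x ∈ O.1)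
          (hG' : ∃ _ : GrpObj ((PolarizedAbelianSchemeWithLevel.baseChange (S' := S''.left) 𝓜'.univ ι'ℚ.left).D.hat.quotientOver S''.hom K'), IsMonHom ((PolarizedAbelianSchemeWithLevel.baseChange (S' := S''.left) 𝓜'.univ ι'ℚ.left).D.hat.quotientMk S''.hom K' hcov'))
          (hsm' : Smooth ((PolarizedAbelianSchemeWithLevel.baseChange (S' := S''.left) 𝓜'.univ ι'ℚ.left).D.hat.quotientOver S''.hom K').hom)
          (hgc' : GeometricallyConnected ((PolarizedAbelianSchemeWithLevel.baseChange (S' := S''.left) 𝓜'.univ ι'ℚ.left).D.hat.quotientOver S''.hom K').hom)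
          (hfree' : ∀ (Ω : Type) [Field Ω] [IsAlgClosed Ω] (x : Spec (.of Ω) ⟶ (PolarizedAbelianSchemeWithLevel.baseChange (S' := S''.left) 𝓜'.univ ι'ℚ.left).D.hat.left) (σ : K'), σ ≠ 1 →
            x ≫ ((PolarizedAbelianSchemeWithLevel.baseChange (S' := S''.left) 𝓜'.univ ι'ℚ.left).D.hat.translation (σ : (PolarizedAbelianSchemeWithLevel.baseChange (S' := S''.left) 𝓜'.univ ι'ℚ.left).D.hat.Sections)).left ≠ x)
          (Φ : (AbelianSchemeOver.prodTranslationActionOver ((PolarizedAbelianSchemeWithLevel.baseChange (S' := S''.left) 𝓜'.univ ι'ℚ.left).A.quotientBy S''.hom K hcov hG hsm hgc) (PolarizedAbelianSchemeWithLevel.baseChange (S' := S''.left) 𝓜'.univ ι'ℚ.left).D.hat S''.hom K' hcov').EquivariantStructure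
            ((PolarizedAbelianSchemeWithLevel.baseChange (S' := S''.left) 𝓜'.univ ι'ℚ.left).A.poincarePullback S''.hom K hK hcov hG hsm hgc (PolarizedAbelianSchemeWithLevel.baseChange (S' := S''.left) 𝓜'.univ ι'ℚ.left).D hfree))
          (h4 : ∀ {T : Scheme} (f : T ⟶ S''.left) (ℒ : ((PolarizedAbelianSchemeWithLevel.baseChange (S' := S''.left) 𝓜'.univ ι'ℚ.left).A.quotientBy S''.hom K hcov hG hsm hgc).RigidifiedLineBundle f),
            ℒ.FibrewisePicZero →
            ∃! g : {g : T ⟶ ((PolarizedAbelianSchemeWithLevel.baseChange (S' := S''.left) 𝓜'.univ ι'ℚ.left).D.hat.quotientBy S''.hom K' hcov' hG' hsm' hgc').X.left //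
                g ≫ ((PolarizedAbelianSchemeWithLevel.baseChange (S' := S''.left) 𝓜'.univ ι'ℚ.left).D.hat.quotientBy S''.hom K' hcov' hG' hsm' hgc').X.hom = f},
              Nonempty ((Scheme.Modules.pullback (((PolarizedAbelianSchemeWithLevel.baseChange (S' := S''.left) 𝓜'.univ ι'ℚ.left).A.quotientBy S''.hom K hcov hG hsm hgc).baseChangeToProd
                ((PolarizedAbelianSchemeWithLevel.baseChange (S' := S''.left) 𝓜'.univ ι'ℚ.left).D.hat.quotientBy S''.hom K' hcov' hG' hsm' hgc') f g.1 g.2)).obj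
                  ((PolarizedAbelianSchemeWithLevel.baseChange (S' := S''.left) 𝓜'.univ ι'ℚ.left).A.poincareQuotRigid S''.hom K hK hcov hG hsm hgc (PolarizedAbelianSchemeWithLevel.baseChange (S' := S''.left) 𝓜'.univ ι'ℚ.left).D hfree K' hcov' hG' hsm' hgc' Φ) ≅ ℒ.L))
          (hlam : ∀ σ : K, (PolarizedAbelianSchemeWithLevel.baseChange (S' := S''.left) 𝓜'.univ ι'ℚ.left).A.translation (σ : (PolarizedAbelianSchemeWithLevel.baseChange (S' := S''.left) 𝓜'.univ ι'ℚ.left).A.Sections) ≫ (PolarizedAbelianSchemeWithLevel.baseChange (S' := S''.left) 𝓜'.univ ι'ℚ.left).pol.lam ≫ (PolarizedAbelianSchemeWithLevel.baseChange (S' := S''.left) 𝓜'.univ ι'ℚ.left).D.hat.quotientMk S''.hom K' hcov' =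
            (PolarizedAbelianSchemeWithLevel.baseChange (S' := S''.left) 𝓜'.univ ι'ℚ.left).pol.lam ≫ (PolarizedAbelianSchemeWithLevel.baseChange (S' := S''.left) 𝓜'.univ ι'ℚ.left).D.hat.quotientMk S''.hom K' hcov')
          (polB : ((PolarizedAbelianSchemeWithLevel.baseChange (S' := S''.left) 𝓜'.univ ι'ℚ.left).A.quotientBy S''.hom K hcov hG hsm hgc).Polarization
            ((PolarizedAbelianSchemeWithLevel.baseChange (S' := S''.left) 𝓜'.univ ι'ℚ.left).A.dualPairOfQuotientRigidified S''.hom K hK hcov hG hsm hgc (PolarizedAbelianSchemeWithLevel.baseChange (S' := S''.left) 𝓜'.univ ι'ℚ.left).D hfree K' hcov' hG' hsm' hgc' hfree' Φ h4))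
          (_ : polB.lam = (PolarizedAbelianSchemeWithLevel.baseChange (S' := S''.left) 𝓜'.univ ι'ℚ.left).A.polarizationDesc S''.hom K hcov (PolarizedAbelianSchemeWithLevel.baseChange (S' := S''.left) 𝓜'.univ ι'ℚ.left).D.hat K' hcov' (PolarizedAbelianSchemeWithLevel.baseChange (S' := S''.left) 𝓜'.univ ι'ℚ.left).pol.lam hlam),
          polB.HasType δ := by
  classical
  intro d hd
  -- ### the link: `δ′ = δ`; the level: `N′ = N·d`
  obtain ⟨-, -, -, -, γ₀, -, r₀, -, hδδ, -, -, -⟩ := id hlink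
  subst δ'
  subst hd
  have hN0 : N ≠ 0 := by omega
  have hd0 : d ≠ 0 := by rintro rfl; exact (NeZero.ne (N * 0)) (Nat.mul_zero N)
  have hdd : N * d / N = d := Nat.mul_div_cancel_left d (Nat.pos_of_ne_zero hN0)
  rw [hdd] at hodd hcop hsim
  have hcop' : Nat.Coprime (∏ i, δ i) d := hcop.symm
  have hN' : 3 ≤ N * d := le_trans hN (Nat.le_mul_of_pos_right N (Nat.pos_of_ne_zero hd0))
  -- ### the piece and the universal family on it
  set P' := PolarizedAbelianSchemeWithLevel.baseChange (S' := S''.left) 𝓜'.univ ι'ℚ.left with hP'def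
  intro _instRed _instLN _instSep _instSepA _instLftA _instSepD _instLftD _instComm K _instFinK hK hfree hKr
  haveI : IsLocallyNoetherian (specOver ℚ ℂ).left := inferInstanceAs (IsLocallyNoetherian (Spec (CommRingCat.of ℂ)))
  haveI : IsLocallyNoetherian (S''.restrictScalars ℚ).left := _instLN
  haveI : Smooth S''.hom := SmoothOfRelativeDimension.smooth d'' _
  haveI : LocallyOfFiniteType S''.hom := inferInstance
  obtain ⟨hMsm, -, hX⟩ := W1.smooth_qproj_of_F hF hg hδ hN' 𝓜'
  haveI : Smooth 𝓜'.M.hom := hMsm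
  haveI : LocallyOfFiniteType 𝓜'.M.hom := inferInstance
  haveI := P'.pol.isMonHom
  haveI : IsCommMonObj P'.D.hat.X := P'.D.hat.isCommMonObj_of_isReduced_base
  haveI : IsReduced P'.D.hat.X.left := P'.D.hat.isReduced_left
  haveI : IsReduced P'.A.X.left := P'.A.isReduced_left
  haveI := P'.A.isSmooth
  haveI := P'.D.hat.isSmooth
  haveI : IsLocallyNoetherian P'.D.hat.X.left := LocallyOfFiniteType.isLocallyNoetherian P'.D.hat.X.hom
  haveI : IsLocallyNoetherian P'.A.X.left := LocallyOfFiniteType.isLocallyNoetherian P'.A.X.hom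
  -- `λ′` is onto on geometric fibre points (the piece is classified by `𝓜′`)
  have hsurj : ∀ ⦃Ω : Type⦄ [Field Ω] [IsAlgClosed Ω] (s : Spec (.of Ω) ⟶ S''.left) (y : P'.D.hat.FibrePoints s),
      ∃ x : P'.A.FibrePoints s, x ≫ P'.pol.lam = y :=
    fun Ω _ _ s y => 𝓜'.exists_comp_lam_eq_of_classify (T := S''.restrictScalars ℚ) P' s y
  -- ### (1) `hcov`: the total space of `A′` is quasi-projective over `ℂ`
  have hcov : ∀ x : P'.A.left, ∃ O : (P'.A.translationActionOver S''.hom K).StableAffineOpens, x ∈ O.1 :=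
    hcov_univ_piece' 𝓜' ι' ι'ℚ hι hX K
  -- ### (2) `hG`, `hsm`, `hgc`
  have hG := P'.A.exists_grpObj_isMonHom_quotientMk S''.hom K hcov hfree
  have hsm := P'.A.smooth_quotientOver_hom_of_hom_spec S''.hom K hcov S''.hom hfree
  have hgc := P'.A.geometricallyConnected_quotientOver_hom S''.hom K hcov
  -- ### (3) `K′ := λ′_* K`, finite; `hfree′`
  haveI hfinK' : Finite (K.map (IsMonHom.monoidHom P'.pol.lam (𝟙_ (Over S''.left)))) :=
    P'.A.finite_map_isMonHom_monoidHom P'.pol.lam K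
  have hfree' := P'.A.translation_ne_of_mem_map_lam P'.pol P'.level P'.hasType hcop' hKr hK
  -- ### (4) `hcov′` — (B5) ★ `hcov'_univ_piece`: the dual total space is covered by `K′`-stable affine opens over `Spec ℂ`
  have hδ0 : ∏ i, δ i ≠ 0 := Finset.prod_ne_zero_iff.2 fun i _ => (hδ.1 i).ne'
  have hcov' := hcov'_univ_piece 𝓜' ι' ι'ℚ hι hX hδ0 (K.map (IsMonHom.monoidHom P'.pol.lam (𝟙_ (Over S''.left))))
  -- ### (5) `hG′`, `hsm′`, `hgc′`
  have hG' := P'.D.hat.exists_grpObj_isMonHom_quotientMk S''.hom _ hcov' hfree'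
  have hsm' := P'.D.hat.smooth_quotientOver_hom_of_hom_spec S''.hom _ hcov' S''.hom hfree'
  have hgc' := P'.D.hat.geometricallyConnected_quotientOver_hom S''.hom _ hcov'
  -- ### (6a) ISOTROPY of the Hecke kernel in the `hfib` shape: (H-iso-3) ★ B-p17 ∘ (H-iso-2) ★ B-p21 ∘ (H-iso-1) ★ p754396
  obtain ⟨γs, hγ1, hγ2, hsimZ, -⟩ := hQA.exists_intDatum hr hN0 rfl hd0 hsim γm hγ
  have hn' : ∀ ⦃Ω : Type⦄ [Field Ω] [IsAlgClosed Ω] (_ : Spec (.of Ω) ⟶ S''.left), (d : Ω) ≠ 0 :=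
    fun Ω _ _ s => natCast_ne_zero_of_over_charZero S''.hom s hd0
  have hiso := P'.A.hiso_of_isLambdaOfAt_of_weilPairingLevel_eq_one S''.hom K hK hcov hG hsm hgc P'.D hfree P'.pol.lam
    P'.relDim hn' fun σ Ω _ _ s => by
      obtain ⟨Θ, hΘa, hΘ⟩ := P'.pol.exists_ample Ω s
      refine ⟨Θ, hΘ, fun κ x y hx hy => ?_⟩
      exact weilPairingLevel_eq_one_of_mem_heckeKernel δ hδ hg hN0 hd0 P' γm γs hγ1 hγ2 hsimZ hr' hKr s Θ hΘa hΘ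
        (natCast_ne_zero_of_over_charZero S''.hom s (NeZero.ne (N * d))) κ σ x y hx hy
  -- ### (6b) `hK′ ≤ Stab(𝒩₁)` ★ p754158 (U2) and `Φ` ★ D3b `poincareStabilizerStructure`
  have hK' := P'.A.map_le_poincareStabilizerSubgroup S''.hom K hK hcov hG hsm hgc P'.D hfree
    P'.pol.nonempty_unitHatSlice_iso P'.pol.lam hiso
  let Φ := P'.A.poincareStabilizerStructure S''.hom K hK hcov hG hsm hgc P'.D hfree
    (K.map (IsMonHom.monoidHom P'.pol.lam (𝟙_ (Over S''.left)))) hcov' hK'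
  -- ### (6c) `h4` — the universal property of the descended rigidified Poincaré sheaf: ★ p753888 (D6 junction, B-p08)
  --          over ★ hStab (B-p09), ★ hdesc (B-p13), with the hat level structure ★ (B-p02), `hK′φ` ★ (B-p19) and the count ★ (B-p15).
  have hNd : N * d = d * N := Nat.mul_comm N d
  obtain ⟨χ, hχ⟩ := 𝓜'.exists_hatLevelStructure_of_classify (T := S''.restrictScalars ℚ) P' hNd (NeZero.ne (N * d)) hcop'
  -- `R′ = r′ mod N·d` is invertible, so the index set `K₀` is killed by `d`
  obtain ⟨Γ, -, hΓres, -, -, -⟩ := exists_similitudeTower δ hδ hg hr'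
  have hR : Matrix.of (fun i j => integralAdeleResidue (N * d)
      ⟨((r' : GL (Fin g ⊕ Fin g) finAdeleQ) : Matrix (Fin g ⊕ Fin g) (Fin g ⊕ Fin g) finAdeleQ) i j,
        entries_mem_integralAdeles_of_mem_principalLevelSubgroup_one hr' i j⟩) =
      ((Γ (N * d) : GL (Fin g ⊕ Fin g) (ZMod (N * d))) : Matrix (Fin g ⊕ Fin g) (Fin g ⊕ Fin g) (ZMod (N * d))) := by
    ext i j
    rw [Matrix.of_apply, hΓres (N * d) i j (entries_mem_integralAdeles_of_mem_principalLevelSubgroup_one hr' i j)]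
  have hm : ∀ c ∈ {c : Fin g ⊕ Fin g → ZMod (N * d) |
      (γm.map (Int.castRingHom (ZMod (N * d))) *
        Matrix.of (fun i j => integralAdeleResidue (N * d)
          ⟨((r' : GL (Fin g ⊕ Fin g) finAdeleQ) : Matrix (Fin g ⊕ Fin g) (Fin g ⊕ Fin g) finAdeleQ) i j,
            entries_mem_integralAdeles_of_mem_principalLevelSubgroup_one hr' i j⟩)) *ᵥ c = 0},
      (d : ZMod (N * d)) • c = 0 := fun c hc =>
    smul_eq_zero_of_kernelIndex γm γs hγ2 (Γ (N * d)) c (by rw [← hR]; exact hc)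
  have hK'φ := P'.level.map_subset_range_section_of_changeLevel P'.pol.lam hNd (NeZero.ne (N * d)) χ hχ hKr hm
  have hcard := P'.level.natCard_mul_natCard_map_lam_eq_pow_of_mem_iff_heckeKernel hδ hg hd0 γm γs hγ1 hsimZ
    (Dvd.intro_left N rfl) hr' P'.pol P'.hasType hcop' hKr hK s'.left
  have hnres : ∀ x : S''.left, (d : S''.left.residueField x) ≠ 0 :=
    fun x => PolarizedAbelianSchemeWithLevel.natCast_residueField_ne_zero_of_charZero S''.hom x hd0
  have h4 : ∀ {T : Scheme} (f : T ⟶ S''.left) (ℒ : (P'.A.quotientBy S''.hom K hcov hG hsm hgc).RigidifiedLineBundle f),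
      ℒ.FibrewisePicZero →
      ∃! g : {g : T ⟶ (P'.D.hat.quotientBy S''.hom _ hcov' hG' hsm' hgc').X.left //
          g ≫ (P'.D.hat.quotientBy S''.hom _ hcov' hG' hsm' hgc').X.hom = f},
        Nonempty ((Scheme.Modules.pullback ((P'.A.quotientBy S''.hom K hcov hG hsm hgc).baseChangeToProd
          (P'.D.hat.quotientBy S''.hom _ hcov' hG' hsm' hgc') f g.1 g.2)).obj
            (P'.A.poincareQuotRigid S''.hom K hK hcov hG hsm hgc P'.D hfree _ hcov' hG' hsm' hgc' Φ) ≅ ℒ.L) :=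
    P'.A.universal_poincareQuotRigid_of_level S''.hom K hK hcov hG hsm hgc P'.D hfree _ hcov' hG' hsm' hgc' hfree' Φ χ hnres
      hcard P'.pol.nonempty_unitHatSlice_iso
      (fun f a a' ha ha' h => P'.A.hStab_of_level_of_natCard_eq S''.hom K hK hcov hG hsm hgc P'.D hfree
        (K.map (IsMonHom.monoidHom P'.pol.lam (𝟙_ (Over S''.left)))) hcov' S''.hom P'.relDim hd0
        P'.pol.nonempty_unitHatSlice_iso χ hK'φ hK' hcard f a a' ha ha' h)
      (fun f c _ _ _ M₁ M₂ h => AbelianSchemeOver.RigidifiedLineBundle.nonempty_iso_of_pullback_prodMap_of_isLocallyNoetherian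
        f c M₁ M₂ h)
  -- ### (7) `hlam`
  have hlam := P'.A.hlam_map S''.hom P'.D.hat P'.pol.lam K hcov'
  -- ### (8) `polB`, `hpolB`
  obtain ⟨polB, hpolB⟩ := P'.A.exists_polarization_lam_eq_polarizationDesc_of_charZero_of_odd S''.hom K hK hcov hG hsm
    hgc P'.D hfree _ hcov' hG' hsm' hgc' hfree' Φ h4 P'.pol hlam S''.hom hodd hsurj
  -- ### (9) `htype`
  have hn : ∀ (Ω : Type) [Field Ω] [IsAlgClosed Ω] (_ : Spec (.of Ω) ⟶ S''.left), (d : Ω) ≠ 0 :=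
    fun Ω _ _ s => natCast_ne_zero_of_over_charZero S''.hom s hd0
  have hlamB := P'.A.surjective_map_fibreHom_of_lam_eq_polarizationDesc S''.hom K hK hcov hG hsm hgc P'.D hfree _ hcov'
    hG' hsm' hgc' hfree' Φ h4 P'.pol hlam polB hpolB hsurj
  -- `ψ̂ ≫ ψ^∨ = [d]_Â′` (★ p753342, B-p05), `|K′| = |K|` (★ p753255), `dim Â′_s = g` (★ `dim_hat_fibre_eq_of_classify`)
  have hψhat := P'.A.quotientMk_hat_comp_dualIsogenyOver_quotientMk_eq_mulN S''.hom K hK hcov hG hsm hgc P'.D hfree _ hcov'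
    hG' hsm' hgc' hfree' Φ h4 P'.pol.nonempty_unitHatSlice_iso
  have hK'K := P'.A.natCard_map_lam_eq_of_mem_iff P'.pol P'.level P'.hasType hcop' hKr hK s'.left
  have hdim' : ∀ ⦃Ω : Type⦄ [Field Ω] (s : Spec (.of Ω) ⟶ S''.left), (P'.D.hat.fibre s).toAbelianVariety.dim = g :=
    fun Ω _ s => 𝓜'.dim_hat_fibre_eq_of_classify (T := S''.restrictScalars ℚ) P' s
  have htype : polB.HasType δ :=
    AbelianSchemeOver.Polarization.hasType_polarizationDesc_of_card_eq P'.A S''.hom K hK hcov hG hsm hgc P'.D hfree _ hcov'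
      hG' hsm' hgc' hfree' Φ h4 P'.pol hlam polB hpolB P'.hasType hcop hn hlamB hψhat hK'K P'.relDim hdim'
  exact ⟨hcov, hG, hsm, hgc, _, hfinK', hcov', hG', hsm', hgc', hfree', Φ, h4, hlam, polB, hpolB, htype⟩

end Summit.HodgeConjecture.HodgeConjecture.Theorems.EquidimHExtOfPiece
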